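import Summits.AtomisticToContinuum.HydrodynamicLimit.Theorems.TwoClocksTransferActivityTailsReduction
import Summits.AtomisticToContinuum.HydrodynamicLimit.Theorems.TwoClocksTransferActivityTailsMeanSquare
import HarnessLib

/-!
# `TransferActivityTails` (stmt-AtomisticToContinuum-16624), line `IdeatorOneSketch`: the second-moment
(Chebyshev) rung — the crux from mean-square closeness of the scaled tagged count to a bounded predictor

Helper file (`--supports stmt-AtomisticToContinuum-16624`) for the crux
`Summit.AtomisticToContinuum.HydrodynamicLimit.Theses.TwoClocks.TransferActivityTails` (route TwoClocks, rank 7), line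
IdeatorOneSketch (idea card `Cruxes/TransferActivityTails/Ideas/tagged-count-chernoff.md`, skeleton
`Cruxes/TransferActivityTails/Lines/IdeatorOneSketch.lean` v3).

The line reduces the crux (landed, `TwoClocksTransferActivityTailsReduction`) to the per-sphere `L¹`-tail rung
`WeightedCountActivityTails` for the scaled energy-marked impulse-truncated window count `b_i(s) = (σ/τ) W_i(s)` of a
tagged sphere, and offers the Chernoff bound `TaggedCountTailBound` (C⁺) as one sufficient handle.  This file adds the
second, differently shaped handle — the one a local-equilibrium + tagged-particle MEAN-ERGODICITY argument would
actually deliver, with no exponential tail and no rate constants: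

* `WeightedCountMeanSquareRung`: in the crux's frame there is a level `A > 0` (chosen after `t`, before `τ`) such that
  for every `δ > 0`, for `τ ≥ τ₀(δ)`, `N ≥ N₀(τ)`, `s ∈ [0,t]` and every sphere `i`, the scaled count `b_i(s)` is within
  `δ` IN MEAN SQUARE of SOME function `m ≤ A` of the datum (a "predictor": e.g. the hydrodynamic activity level at
  the sphere's current macroscopic position, capped at `A`; at global equilibrium a constant):
  `E_λ[(b_i(s) − m)²] ≤ δ`.
* `weightedCountActivityTails_of_meanSquareRung`: this implies the rung, with `V₀ := A + 1` — pointwise, for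
  `V ≥ A + 1 ≥ m + 1`, `b 𝟙{b > V} ≤ (A + 1)(b − m)²` (the landed `TransferActivityTailsMeanSquare.tailFn_le_mul_sq`: on `{b > V}`
  put `d = b − m ≥ 1`; then `b = m + d ≤ (A + 1) d ≤ (A + 1) d²`), so `E[b_i 𝟙{b_i > V}] ≤ (A+1) E[(b_i − m)²] ≤ (A+1) δ = ε`
  for `δ := ε/(A+1)`.
* `transferActivityTails_of_meanSquareRung`: hence the crux (compose with the landed
  `transferActivityTails_of_weightedCountActivityTails`).

Neither handle implies the other (C⁺ controls only the far upper tail, the mean-square rung only the bulk); both are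
OPEN dynamical statements (as is the averaged dock `TransferActivityTailsMeanSquare.TransferActivityMeanSquare → crux`, landed
separately, which states the same `L²` shape for the crux's own activity `a_i`, averaged over the spheres) about the true pre-shock hard-sphere law at fixed packing (no N-uniform control of a tagged
sphere's collision statistics over `τσ² → ∞` mean free times is in print, at or off equilibrium — Spohn 1991 Part I
Ch. 3; Bodineau–Gallagher–Saint-Raymond–Simonella 2023 work at Boltzmann–Grad scaling and finite kinetic times).
Nothing here is a cited fact; the two `def`s are route-internal statements of the line.

References: H. Spohn, *Large Scale Dynamics of Interacting Particles* (1991), Part I Ch. 3 (local equilibrium; the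
tagged-particle / hydrodynamic LLN as the missing input); I. Gallagher, L. Saint-Raymond, B. Texier, *From Newton to
Boltzmann* (2013) §1.1.
-/

noncomputable section

open MeasureTheory Set Filter Topology
open scoped ENNReal BigOperators

namespace Summit.AtomisticToContinuum.HydrodynamicLimit.Theorems.TransferActivityTailsSecondMomentRung

open Literature.MathematicalPhysics.KineticTheory Literature.Analysis.FluidPDE
open Summit.AtomisticToContinuum.HydrodynamicLimit.Theorems.CollisionActivityTailsEndpointTails
  (Flow Cfg window tailFn tailFn_of_lt tailFn_of_le)
open Summit.AtomisticToContinuum.HydrodynamicLimit.Theorems.TransferActivityTailsWeightedCountAEMeasurable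
  (weightedCount)
open Summit.AtomisticToContinuum.HydrodynamicLimit.Theorems.TransferActivityTailsReduction
  (WeightedCountActivityTails transferActivityTails_of_weightedCountActivityTails)
open Summit.AtomisticToContinuum.HydrodynamicLimit.Theorems.TransferActivityTailsMeanSquare (tailFn_le_mul_sq)

/-! ## §1 The second-moment rung (statement) -/

/-- **Second-moment (Chebyshev) rung of line IdeatorOneSketch** (route-internal statement for crux
TransferActivityTails (stmt-AtomisticToContinuum-16624); NOT a cited fact, not claimed, OPEN).  In the crux's frame
(continuous positive profiles, `σ < σ₀`, classical hs-Euler solution on `[0, T)` tied to the data by the `t = 0` LLN,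
every flow family, `t < T`): there is a level `A > 0` such that for every `δ > 0` there is `τ₀ > 0` with: for all
`τ ≥ τ₀` there is `N₀` such that for `N ≥ N₀`, `s ∈ [0, t]` and every sphere `i` SOME function `m ≤ A` of the
initial datum predicts the scaled energy-marked impulse-truncated window count `b_i(s) = (σ/τ) W_i(s)` to within
`δ` in mean square under the local Gibbs law: `∫ (b_i(s) − m)² dλ ≤ δ`.  (Local equilibrium + mean-ergodicity of the
tagged sphere's collision process over `τσ² → ∞` mean free times; at global equilibrium `m` is a constant.) -/
def WeightedCountMeanSquareRung : Prop :=
  ∀ (a₀ θ₀ : T3 → ℝ) (u₀ : T3 → V3), Continuous a₀ → Continuous θ₀ → Continuous u₀ →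
    (∀ x, 0 < a₀ x) → (∀ x, 0 < θ₀ x) → ∃ σ₀ : ℝ, 0 < σ₀ ∧ ∀ σ : ℝ, 0 < σ → σ < σ₀ →
    ∀ (T : ℝ) (ρ θ : ℝ → T3 → ℝ) (u : ℝ → T3 → V3), IsHardSphereEulerSolution σ T ρ u θ →
    ∀ Φ : (N : ℕ) → Flow σ N,
    TendstoHydroFieldsAt (fun N => localGibbsLaw σ a₀ u₀ θ₀ N (Φ N)) Φ ρ u θ 0 →
    ∀ t ∈ Set.Ico 0 T, ∃ A : ℝ, 0 < A ∧ ∀ δ : ℝ, 0 < δ → ∃ τ₀ : ℝ, 0 < τ₀ ∧ ∀ τ : ℝ, τ₀ ≤ τ →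
    ∃ N₀ : ℕ, ∀ N : ℕ, N₀ ≤ N → ∀ s ∈ Set.Icc 0 t, ∀ i : Fin (N + 1),
    ∃ m : Cfg N → ℝ, (∀ z, m z ≤ A) ∧
      ∫⁻ z, ENNReal.ofReal ((σ / τ * weightedCount (Φ N) τ s i z - m z) ^ 2)
        ∂(localGibbsLaw σ a₀ u₀ θ₀ N (Φ N)) ≤ ENNReal.ofReal δ

/-! ## §2 The rung from the second-moment rung

The pointwise Chebyshev-type inequality `y 𝟙{y > V} ≤ (A + 1)(y − m)²` (`m ≤ A`, `A + 1 ≤ V`) is the landed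
`TransferActivityTailsMeanSquare.tailFn_le_mul_sq`. -/

/-- **The per-sphere `L¹` tails of the scaled count from the second-moment rung.**  Same `σ₀`; `V₀ := A + 1`; for
`V ≥ V₀` and `ε > 0` take `δ := ε / (A + 1)` and the rung's `τ₀(δ)`, `N₀(τ)`; then for `N ≥ N₀`, `s ∈ [0,t]`, `i`,
with the predictor `m ≤ A`: pointwise `b_i 𝟙{b_i > V} ≤ (A+1)(b_i − m)²` (`tailFn_le_mul_sq`), hence
`E[b_i 𝟙{b_i > V}] ≤ (A+1) E[(b_i − m)²] ≤ (A+1) δ = ε`. -/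
theorem weightedCountActivityTails_of_meanSquareRung (h : WeightedCountMeanSquareRung) :
    WeightedCountActivityTails := by
  intro a₀ θ₀ u₀ ha hθ hu ha0 hθ0
  obtain ⟨σ₀, hσ₀, H⟩ := h a₀ θ₀ u₀ ha hθ hu ha0 hθ0
  refine ⟨σ₀, hσ₀, ?_⟩
  intro σ hσ hσlt T ρ θ u hE Φ hlim t ht
  obtain ⟨A, hA, HA⟩ := H σ hσ hσlt T ρ θ u hE Φ hlim t ht
  refine ⟨A + 1, by linarith, ?_⟩
  intro V hV ε hε
  have hA1 : 0 < A + 1 := by linarith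
  obtain ⟨τ₀, hτ₀, Hτ⟩ := HA (ε / (A + 1)) (div_pos hε hA1)
  refine ⟨τ₀, hτ₀, ?_⟩
  intro τ hτ
  obtain ⟨N₀, HN⟩ := Hτ τ hτ
  refine ⟨N₀, ?_⟩
  intro N hN s hs i
  obtain ⟨m, hmA, hL⟩ := HN N hN s hs i
  set P := localGibbsLaw σ a₀ u₀ θ₀ N (Φ N)
  -- pointwise domination of the tail functional by the squared deviation
  have hptw : ∀ z, tailFn V (σ / τ * weightedCount (Φ N) τ s i z) ≤
      (A + 1) * (σ / τ * weightedCount (Φ N) τ s i z - m z) ^ 2 := fun z =>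
    tailFn_le_mul_sq hA.le (hmA z) hV
  calc ∫⁻ z, ENNReal.ofReal (tailFn V (σ / τ * weightedCount (Φ N) τ s i z)) ∂P
      ≤ ∫⁻ z, ENNReal.ofReal ((A + 1) * (σ / τ * weightedCount (Φ N) τ s i z - m z) ^ 2) ∂P :=
        lintegral_mono fun z => ENNReal.ofReal_le_ofReal (hptw z)
    _ = ∫⁻ z, ENNReal.ofReal (A + 1) *
          ENNReal.ofReal ((σ / τ * weightedCount (Φ N) τ s i z - m z) ^ 2) ∂P := by
        refine lintegral_congr fun z => ?_
        rw [ENNReal.ofReal_mul hA1.le]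
    _ = ENNReal.ofReal (A + 1) *
          ∫⁻ z, ENNReal.ofReal ((σ / τ * weightedCount (Φ N) τ s i z - m z) ^ 2) ∂P :=
        lintegral_const_mul' _ _ ENNReal.ofReal_ne_top
    _ ≤ ENNReal.ofReal (A + 1) * ENNReal.ofReal (ε / (A + 1)) := by
        gcongr
    _ = ENNReal.ofReal ε := by
        rw [← ENNReal.ofReal_mul hA1.le, mul_div_cancel₀ _ hA1.ne']

/-! ## §3 The crux from the second-moment rung -/

/-- **The crux from the second-moment rung** (compose §3 with the landed reduction
`transferActivityTails_of_weightedCountActivityTails`): whoever proves `WeightedCountMeanSquareRung` closes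
`TransferActivityTails` with a three-line `--workitem` file. -/
theorem transferActivityTails_of_meanSquareRung (h : WeightedCountMeanSquareRung) :
    Summit.AtomisticToContinuum.HydrodynamicLimit.Theses.TwoClocks.TransferActivityTails :=
  transferActivityTails_of_weightedCountActivityTails (weightedCountActivityTails_of_meanSquareRung h)

/-! ## §4 The registered reduction stub -/

/-- **The per-sphere `L¹` rung from the second-moment rung** (registered stub `stub_weightedCountActivityTails_of_meanSquareRung`
of line IdeatorOneSketch, crux TransferActivityTails (stmt-AtomisticToContinuum-16624); sorry-free; conditional only on the displayed
antecedent). -/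
theorem stub_weightedCountActivityTails_of_meanSquareRung : WeightedCountMeanSquareRung → WeightedCountActivityTails :=
  fun h => weightedCountActivityTails_of_meanSquareRung h

end Summit.AtomisticToContinuum.HydrodynamicLimit.Theorems.TransferActivityTailsSecondMomentRung

end
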